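import Literature.MathematicalPhysics.QuantumLattice.SectorSymbolLineBounds
import Literature.MathematicalPhysics.QuantumLattice.HubbardSectorPhaseSpaceCount
import Literature.Probability.LatticeModels.SampledSymbolTorusDecay
import Literature.MathematicalPhysics.QuantumLattice.TorusSectorPropagatorConstants
import HarnessLib

/-!
# The single-scale sector propagator on the finite space-time torus: `h`-uniform decay and `L¹` bounds (BGM Lemma 2.2 at finite `(β, L)`)

Topic `MathematicalPhysics/QuantumLattice`.  Benfatto–Giuliani–Mastropietro 2006, Lemma 2.2 with footnote ¹ ("our bounds
can be adapted also to the finite `L` case, and the resulting estimates turn out to be uniform in `L`"): the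
single-scale anisotropic sector propagator

  `g^{(h)}_ω(x) = (βL²)⁻¹ Σ_{k ∈ D_{β,M} × (2π/L)(ℤ/Lℤ)²} e^{i(k⃗·x⃗ - k₀x₀)} F_{h,ω}(k) χ(k⃗) / (-ik₀ + ε(k⃗) - μ)`

at inverse temperature `β` (the `2M` kept Matsubara frequencies `π(2(i-M)+1)/β`) on the torus `(ℤ/Lℤ)²` obeys, for
`h = -n` above the temperature scale and `L, M` large, the SAME bounds as in infinite volume at zero temperature
(`SectorPropagatorDecay.sectorPropagator_decay`, `SectorPropagatorL1`): sup `O(γ^{3h/2})` and moment-weighted `L¹` norm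
`O(γ^{-h})` (`γ = 4`), uniformly in `h`, the sector, `β`, `L` and `M`.  Here this is PROVED for the character sum
`S(z) = Σ_p χ_{p₁}(z₁)χ_{p₂}(z₂) • σ(ω_{p₁}, 2πp̃₂/L)` (`σ = sectorSymbol`, so `g = (βL²)⁻¹ S` up to the unimodular
Matsubara phase of `HubbardSpaceTimeCharacters.lean`), by instantiating the generic lattice Lemma 2.2
(`SampledSymbolTorusDecay.lean`) with the `h`-uniform line-derivative bounds and the support of the sector symbol
(`SectorSymbolLineBounds.lean`) and the sector phase-space count (`HubbardSectorPhaseSpaceCount.lean`):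

* `card_support_sampledSectorSymbol_le`, `sampledSectorSymbol_time_seam`, `sampledSectorSymbol_zone_seam` — the
  support count of the sampled symbol (frequency window × rotated box) and its vanishing near the two seams; the
  integer tangent approximant and the constant arithmetic are in `TorusSectorPropagatorConstants.lean`;
* **`torusSectorSum_bounds`** — for `-4 < μ < -2-√2`, `0 < e₀ ≤ (4+μ)/2`, `N ≥ N_w + 7`: there is `C` such that for all
  scales `n`, sectors `ω < 2^{n+1}`, `β > 0` with `3π 4ⁿ ≤ e₀ β` (scale above the temperature), `M ≥ β` with
  `βe₀ ≤ 2π(M - N)`, and `L ≥ 64(N+1)16ⁿ`: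
  (sup) `‖S(z)‖ ≤ C βL² 4^{-n}2^{-n}` for all `z`;
  (weighted `L¹`) `(β/2M) Σ_z (1 + (β/(π4ⁿM))|z̃₁| + (1/(π4ⁿ))(|z̃₂₁| + |z̃₂₂|))^{N_w} ‖S(z)‖ ≤ C βL² 4ⁿ` —
  i.e. `|g| ≤ Cγ^{3h/2}` and `∫dx (1 + γ^h|x|)^{N_w} |g(x)| ≤ Cγ^{-h}` with `∫dx = (β/2M) Σ_x`, (2.52)/(2.81)/(3.2).

Everything is proved; no definitions, no named facts.

## Sources

G. Benfatto, A. Giuliani, V. Mastropietro, Ann. Henri Poincaré 7 (2006) 809–898, §2.5 Lemma 2.2 (2.49)–(2.52), §2.6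
(2.81), §3 (3.2) and footnote ¹ (`BenfattoGiulianiMastropietro2006`); G. Benfatto, A. Giuliani, V. Mastropietro, Ann.
Henri Poincaré 4 (2003) 137–193, §7.2 (`BenfattoGiulianiMastropietro2003`).
-/

noncomputable section

namespace Literature.MathematicalPhysics.QuantumLattice

open Finset Complex Literature.Probability.LatticeModels Literature.Analysis.Calculus
open scoped Real

/-! ### The sampled sector symbol: support count and the seams -/

section Model

variable {μ : ℝ} (hμ₁ : -4 < μ) (hμ₂ : μ < -2 - Real.sqrt 2)
include hμ₁ hμ₂

omit hμ₁ hμ₂ in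
/-- The sampled frequency is the Matsubara frequency: `π(1-2M)/β + (2π/β) i = π(2(i-M)+1)/β = ω_i`. [folklore] -/
theorem sample_time_eq_matsubaraFreq {M : ℕ} (β : ℝ) (i : MatsubaraIdx M) :
    π * (1 - 2 * M) / β + 2 * π / β * ((i : ℕ) : ℝ) = matsubaraFreq β M i := by
  simp only [matsubaraFreq, matsubaraInt]
  push_cast
  ring

omit hμ₁ hμ₂ in
/-- `C₁ ≥ 0`. [folklore] -/
theorem normalExtentConst_nonneg (hμ₁ : -4 < μ) (hμ₂ : μ < -2 - Real.sqrt 2) {e₀ : ℝ} (he : 0 < e₀) :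
    0 ≤ normalExtentConst μ e₀ := by
  have h := normalExtent_nonneg hμ₁ hμ₂ he 0
  rw [normalExtent_eq] at h
  simpa using h

omit hμ₂ in
/-- `C₂ ≥ 0`. [folklore] -/
theorem tangentExtentConst_nonneg {e₀ : ℝ} (he : 0 < e₀) : 0 ≤ tangentExtentConst μ e₀ := by
  have h := (tangentExtent_nonneg hμ₁ he 0).trans (tangentExtent_le hμ₁ he.le 0)
  simpa using h

/-- **The support count of the sampled sector symbol**: the number of points `p` of the product torus where
`σ(ω_{p₁}, 2πp̃₂/L) ≠ 0` is at most `(e₀4^{-n}β/π + 3)(√2 L C₁4^{-n}/π + 2)(√2 L C₂2^{-n}/π + 2)`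
(frequency window × rotated box, `HubbardSectorPhaseSpaceCount`). [cite: BenfattoGiulianiMastropietro2006, §2.5 (2.50)] -/
theorem card_support_sampledSectorSymbol_le {e₀ : ℝ} (he : 0 < e₀) (he' : e₀ ≤ (4 + μ) / 2) (n : ℕ) (ω : ℤ)
    {β : ℝ} (hβ : 0 < β) (L M : ℕ) [NeZero L] [NeZero M]
    [DecidablePred fun p : TorusSite 1 (2 * M) × TorusSite 2 L =>
      sectorSymbol e₀ μ n ω (π * (1 - 2 * M) / β + 2 * π / β * (((p.1 0).val : ℕ) : ℝ),
        fun j => 2 * π / L * (((p.2 j).valMinAbs : ℤ) : ℝ)) ≠ 0] :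
    (((univ.filter fun p : TorusSite 1 (2 * M) × TorusSite 2 L =>
        sectorSymbol e₀ μ n ω (π * (1 - 2 * M) / β + 2 * π / β * (((p.1 0).val : ℕ) : ℝ),
          fun j => 2 * π / L * (((p.2 j).valMinAbs : ℤ) : ℝ)) ≠ 0).card : ℕ) : ℝ) ≤
      (e₀ * (4 : ℝ) ^ (-(n : ℤ)) * β / π + 3) *
        ((Real.sqrt 2 * L * (normalExtentConst μ e₀ * (4 : ℝ) ^ (-(n : ℤ))) / π + 2) *
          (Real.sqrt 2 * L * (tangentExtentConst μ e₀ * (2 : ℝ) ^ (-(n : ℤ))) / π + 2)) := by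
  classical
  set θ₀ : ℝ := ((ω : ℝ) + 1 / 2) * sectorWidth n with hθ₀
  have hnrm := fermiNormal_normSq hμ₁ hμ₂ θ₀
  have htan := fermiTangent_normSq hμ₁ hμ₂ θ₀
  have hdot : fermiNormal μ θ₀ 0 * fermiTangent μ θ₀ 0 + fermiNormal μ θ₀ 1 * fermiTangent μ θ₀ 1 = 0 := by
    have := fermiTangent_dot_fermiNormal μ θ₀; linarith [this]
  have hB₁ : 0 ≤ normalExtentConst μ e₀ * (4 : ℝ) ^ (-(n : ℤ)) :=
    mul_nonneg (normalExtentConst_nonneg hμ₁ hμ₂ he) (zpow_nonneg (by norm_num) _)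
  have hB₂ : 0 ≤ tangentExtentConst μ e₀ * (2 : ℝ) ^ (-(n : ℤ)) :=
    mul_nonneg (tangentExtentConst_nonneg hμ₁ he) (zpow_nonneg (by norm_num) _)
  have ha : 0 ≤ e₀ * (4 : ℝ) ^ (-(n : ℤ)) := mul_nonneg he.le (zpow_nonneg (by norm_num) _)
  have hcount := card_filter_freqMomentum_le (L := L) (M := M) hβ ha hnrm htan hdot ![fermiX μ θ₀, fermiY μ θ₀] hB₁ hB₂
  refine le_trans ?_ hcount
  -- inject the support of the sample into the counted set
  have hval : ∀ p : TorusSite 1 (2 * M) × TorusSite 2 L, (p.1 0).val < 2 * M := fun p => ZMod.val_lt _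
  refine Nat.cast_le.2 (card_le_card_of_injOn (fun p => (⟨(p.1 0).val, hval p⟩, p.2)) (fun p hp => ?_) ?_)
  · have hne := (mem_filter.1 hp).2
    obtain ⟨h0, hn1, ht1, -⟩ := sectorSymbol_support hμ₁ hμ₂ he he' hne
    dsimp only at h0 hn1 ht1
    rw [← hθ₀] at hn1 ht1
    simp only [coe_filter, Set.mem_setOf_eq, mem_univ, true_and]
    have e0 : 2 * π * ((((p.2 0).valMinAbs : ℤ) : ℝ)) / L = 2 * π / L * (((p.2 0).valMinAbs : ℤ) : ℝ) := by ring
    have e1 : 2 * π * ((((p.2 1).valMinAbs : ℤ) : ℝ)) / L = 2 * π / L * (((p.2 1).valMinAbs : ℤ) : ℝ) := by ring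
    refine ⟨?_, ?_, ?_⟩
    · rw [← sample_time_eq_matsubaraFreq]; exact h0
    · simp only [Matrix.cons_val_zero, Matrix.cons_val_one]
      rw [e0, e1]; exact hn1
    · simp only [Matrix.cons_val_zero, Matrix.cons_val_one]
      rw [e0, e1]; exact ht1
  · intro p _ q _ h
    have h' : ((⟨(p.1 0).val, hval p⟩ : MatsubaraIdx M), p.2) = (⟨(q.1 0).val, hval q⟩, q.2) := h
    obtain ⟨h1, h2⟩ := Prod.mk.inj h'
    have h1' : (p.1 0).val = (q.1 0).val := Fin.mk.inj_iff.1 h1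
    refine Prod.ext (funext fun i => ?_) h2
    rw [Subsingleton.elim i 0]
    exact ZMod.val_injective _ h1'

/-- **The time seam**: if `βe₀ ≤ 2π(M - N)` then the sampled symbol vanishes for the integer indices `m < N` and
`m ≥ 2M - N` (there `|ω| ≥ π(2M-2N+1)/β > e₀ ≥ e₀4^{-n}`). [folklore] -/
theorem sampledSectorSymbol_time_seam {e₀ : ℝ} (he : 0 < e₀) (he' : e₀ ≤ (4 + μ) / 2) (n : ℕ) (ω : ℤ)
    {β : ℝ} (hβ : 0 < β) {M N : ℕ} (hM : β * e₀ ≤ 2 * π * ((M : ℝ) - N)) (m : ℤ) (k : Fin 2 → ℝ)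
    (hm : m < N ∨ ((2 * M : ℕ) : ℤ) ≤ m + N) :
    sectorSymbol e₀ μ n ω (π * (1 - 2 * M) / β + 2 * π / β * (m : ℝ), k) = 0 := by
  by_contra hne
  obtain ⟨h0, -⟩ := sectorSymbol_support hμ₁ hμ₂ he he' hne
  dsimp only at h0
  have h4 : (4 : ℝ) ^ (-(n : ℤ)) ≤ 1 := zpow_le_one_of_nonpos₀ (by norm_num) (by simp)
  have hk0 : |π * (1 - 2 * M) / β + 2 * π / β * (m : ℝ)| ≤ e₀ := h0.trans (mul_le_of_le_one_right he.le h4)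
  have heq : π * (1 - 2 * M) / β + 2 * π / β * (m : ℝ) = π / β * (2 * ((m : ℝ) - M) + 1) := by
    field_simp; ring
  rw [heq, abs_mul, abs_of_pos (by positivity : (0 : ℝ) < π / β)] at hk0
  have hMN : (N : ℝ) < M := by
    by_contra h
    push Not at h
    have : 2 * π * ((M : ℝ) - N) ≤ 0 := by nlinarith [Real.pi_pos]
    nlinarith [mul_pos hβ he]
  have hbig : 2 * ((M : ℝ) - N) + 1 ≤ |2 * ((m : ℝ) - M) + 1| := by
    rcases hm with hm | hm
    · have : (m : ℝ) + 1 ≤ N := by exact_mod_cast hm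
      rw [abs_of_neg (by linarith)]; linarith
    · have : (2 * (M : ℝ)) ≤ m + N := by exact_mod_cast hm
      rw [abs_of_nonneg (by linarith)]; linarith
  have hfin : π * (2 * ((M : ℝ) - N) + 1) ≤ e₀ * β := by
    have h := (mul_le_mul_of_nonneg_left hbig (by positivity : (0 : ℝ) ≤ π / β)).trans hk0
    rw [div_mul_eq_mul_div, div_le_iff₀ hβ] at h
    exact h
  nlinarith [Real.pi_pos]

/-- **The zone seam**: if `4NW < L` then the sampled symbol vanishes at the integer momenta `m` with
`2|m_j| + 2NW ≥ L` for some `j` (there `|2πm_j/L| > π/2`, outside the central copy of the zone). [folklore] -/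
theorem sampledSectorSymbol_zone_seam {e₀ : ℝ} (he : 0 < e₀) (he' : e₀ ≤ (4 + μ) / 2) (n : ℕ) (ω : ℤ)
    {L N : ℕ} [NeZero L] {W : ℤ} (hW : 4 * (N : ℤ) * W < L) (k₀ : ℝ) (m : Fin 2 → ℤ)
    (hm : ∃ j, (L : ℤ) ≤ 2 * |m j| + 2 * N * W) :
    sectorSymbol e₀ μ n ω (k₀, fun j => 2 * π / L * (m j : ℝ)) = 0 := by
  by_contra hne
  obtain ⟨-, -, -, hz⟩ := sectorSymbol_support hμ₁ hμ₂ he he' hne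
  obtain ⟨j, hj⟩ := hm
  have hL : (0 : ℝ) < L := Nat.cast_pos.2 (Nat.pos_of_ne_zero (NeZero.ne L))
  have hzj : |2 * π / L * (m j : ℝ)| ≤ π / 2 := hz j
  rw [abs_mul, abs_of_pos (by positivity : (0 : ℝ) < 2 * π / L)] at hzj
  have h1 : 4 * |(m j : ℝ)| ≤ L := by
    have := mul_le_mul_of_nonneg_left hzj (by positivity : (0 : ℝ) ≤ 2 * L / π)
    have e1 : 2 * L / π * (2 * π / L * |(m j : ℝ)|) = 4 * |(m j : ℝ)| := by field_simp; ring
    have e2 : 2 * L / π * (π / 2) = L := by field_simp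
    linarith [e1, e2]
  have h2 : (L : ℝ) ≤ 2 * |(m j : ℝ)| + 2 * N * W := by
    have := hj; rw [← Int.cast_abs] ; exact_mod_cast this
  have h3 : 4 * (N : ℝ) * W < L := by exact_mod_cast hW
  linarith

omit hμ₁ hμ₂ in
/-- `n = (τ₂, -τ₁)`: the normal is the rotated tangent. [folklore] -/
theorem fermiNormal_eq_rot (θ : ℝ) :
    fermiNormal μ θ 0 = fermiTangent μ θ 1 ∧ fermiNormal μ θ 1 = -fermiTangent μ θ 0 := by
  simp [fermiNormal, fermiTangent]

end Model

section Main

variable {μ : ℝ} (hμ₁ : -4 < μ) (hμ₂ : μ < -2 - Real.sqrt 2)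
include hμ₁ hμ₂

set_option maxHeartbeats 400000 in -- buildfix 2026-08-19: the proof sits at the default budget (~200k measured)
/-- **Benfatto–Giuliani–Mastropietro's Lemma 2.2 on the finite space-time torus** (sup and moment-weighted `L¹`
bounds of the single-scale sector character sum, uniformly in the scale, the sector, `β`, `L`, `M`): see the module
docstring. [cite: BenfattoGiulianiMastropietro2006, §2.5 Lemma 2.2 (2.52), §2.6 (2.81), §3 (3.2) and footnote 1] -/
theorem torusSectorSum_bounds {e₀ : ℝ} (he : 0 < e₀) (he' : e₀ ≤ (4 + μ) / 2) {N Nw : ℕ} (hN : Nw + 7 ≤ N) :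
    ∃ C : ℝ, 0 ≤ C ∧ ∀ (n : ℕ) (ω : ℕ), ω < sectorCount n → ∀ (β : ℝ), 0 < β → 3 * π * 4 ^ n ≤ e₀ * β →
      ∀ (L M : ℕ) [NeZero L] [NeZero M], β ≤ M → β * e₀ ≤ 2 * π * ((M : ℝ) - N) →
      64 * ((N : ℝ) + 1) * 16 ^ n ≤ L →
      (∀ z : TorusSite 1 (2 * M) × TorusSite 2 L,
        ‖∑ p : TorusSite 1 (2 * M) × TorusSite 2 L, (torusChar p.1 z.1 * torusChar p.2 z.2) •
            sectorSymbol e₀ μ n ω (π * (1 - 2 * M) / β + 2 * π / β * (((p.1 0).val : ℕ) : ℝ),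
              fun j => 2 * π / L * (((p.2 j).valMinAbs : ℤ) : ℝ))‖ ≤
          C * (β * (L : ℝ) ^ 2) * ((4 : ℝ) ^ n)⁻¹ * ((2 : ℝ) ^ n)⁻¹) ∧
      β / (2 * M) * ∑ z : TorusSite 1 (2 * M) × TorusSite 2 L,
        (1 + β / (π * 4 ^ n * M) * |(((z.1 0).valMinAbs : ℤ) : ℝ)| +
            1 / (π * 4 ^ n) * (|(((z.2 0).valMinAbs : ℤ) : ℝ)| + |(((z.2 1).valMinAbs : ℤ) : ℝ)|)) ^ Nw *
          ‖∑ p : TorusSite 1 (2 * M) × TorusSite 2 L, (torusChar p.1 z.1 * torusChar p.2 z.2) •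
            sectorSymbol e₀ μ n ω (π * (1 - 2 * M) / β + 2 * π / β * (((p.1 0).val : ℕ) : ℝ),
              fun j => 2 * π / L * (((p.2 j).valMinAbs : ℤ) : ℝ))‖ ≤
        C * (β * (L : ℝ) ^ 2) * (4 : ℝ) ^ n := by
  classical
  obtain ⟨B, hB0, hB⟩ := exists_norm_iteratedDeriv_sectorSymbol_line_le hμ₁ hμ₂ he he' N
  have hπ := Real.pi_pos
  -- the constants
  have hC₁0 : 0 ≤ normalExtentConst μ e₀ := normalExtentConst_nonneg hμ₁ hμ₂ he
  have hC₂0 : 0 ≤ tangentExtentConst μ e₀ := tangentExtentConst_nonneg hμ₁ he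
  obtain ⟨D₀, hD₀⟩ : ∃ D₀ : ℝ, D₀ = (2 * e₀ / π) *
      ((Real.sqrt 2 * normalExtentConst μ e₀ / π + 2) * (Real.sqrt 2 * tangentExtentConst μ e₀ / π + 2)) := ⟨_, rfl⟩
  obtain ⟨D₁, hD₁⟩ : ∃ D₁ : ℝ, D₁ = 8 * (6 * Real.sqrt 2 * π + 2) ^ 2 + 8 * π * (π + 1) ^ 2 := ⟨_, rfl⟩
  obtain ⟨Ca, hCa⟩ : ∃ Ca : ℝ, Ca = 6 ^ N * D₀ * (16 / e₀ + 5 * ((N : ℝ) + 1) * B) := ⟨_, rfl⟩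
  have hD₀0 : 0 ≤ D₀ := by rw [hD₀]; positivity
  have hD₁0 : 0 ≤ D₁ := by rw [hD₁]; positivity
  have hCa0 : 0 ≤ Ca := by rw [hCa]; positivity
  refine ⟨Ca * (1 + 16 * (π + 1) * D₁), by positivity, ?_⟩
  intro n ω hω β hβ hβn L M _ _ hβM hM hL
  -- scale bookkeeping: `x = 4ⁿ`, `y = 2ⁿ`
  have hLpos : (0 : ℝ) < L := Nat.cast_pos.2 (Nat.pos_of_ne_zero (NeZero.ne L))
  have hMpos : (0 : ℝ) < M := Nat.cast_pos.2 (Nat.pos_of_ne_zero (NeZero.ne M))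
  have hx : (0 : ℝ) < 4 ^ n := by positivity
  have hy : (0 : ℝ) < 2 ^ n := by positivity
  have hxy : (4 : ℝ) ^ n = (2 ^ n) ^ 2 := by rw [← pow_mul, mul_comm, pow_mul]; norm_num
  have h1y : (1 : ℝ) ≤ 2 ^ n := one_le_pow₀ (by norm_num)
  have h1x : (1 : ℝ) ≤ 4 ^ n := one_le_pow₀ (by norm_num)
  have hyx : (2 : ℝ) ^ n ≤ 4 ^ n := pow_le_pow_left₀ (by norm_num) (by norm_num) n
  have h16 : (16 : ℝ) ^ n = 4 ^ n * 4 ^ n := by rw [← mul_pow]; norm_num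
  have h8 : (8 : ℝ) ^ n = 4 ^ n * 2 ^ n := by rw [← mul_pow]; norm_num
  have hxL : (4 : ℝ) ^ n ≤ L := by nlinarith [mul_nonneg (by positivity : (0 : ℝ) ≤ 64 * ((N : ℝ) + 1)) hx.le]
  have hyL : (2 : ℝ) ^ n ≤ L := hyx.trans hxL
  -- the frame at the sector centre
  obtain ⟨hn0, hn1⟩ := fermiNormal_eq_rot (μ := μ) (((ω : ℝ) + 1 / 2) * sectorWidth n)
  have htan1 := fermiTangent_normSq hμ₁ hμ₂ (((ω : ℝ) + 1 / 2) * sectorWidth n)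
  obtain ⟨ht0, ht1⟩ := abs_le_one_of_sq_add_sq htan1
  -- the integer tangent approximant
  obtain ⟨v, hv0, hvt, hvn, hvlen, hvl1⟩ := exists_int_frame_approx _ htan1 h1y
  have hvt' : |fermiTangent μ (((ω : ℝ) + 1 / 2) * sectorWidth n) 0 * (v 0 : ℝ) +
      fermiTangent μ (((ω : ℝ) + 1 / 2) * sectorWidth n) 1 * (v 1 : ℝ)| ≤ 2 ^ n + 1 := by
    have := abs_le.1 hvt; rw [abs_le]; constructor <;> linarith
  -- steps and rates
  have hh₀ : (0 : ℝ) < 2 * π / β := by positivity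
  have hhx : (0 : ℝ) < 2 * π / L := by positivity
  have hΦs : ContDiff ℝ N (sectorSymbol e₀ μ n (ω : ℤ)) := contDiff_sectorSymbol hμ₁ hμ₂ he he' n (ω : ℤ)
  have hG : ∀ p : TorusSite 1 (2 * M) × TorusSite 2 L,
      (fun p : TorusSite 1 (2 * M) × TorusSite 2 L => sectorSymbol e₀ μ n (ω : ℤ)
        (π * (1 - 2 * M) / β + 2 * π / β * (((p.1 0).val : ℕ) : ℝ), fun j => 2 * π / L * (((p.2 j).valMinAbs : ℤ) : ℝ))) p =
      sectorSymbol e₀ μ n (ω : ℤ) (π * (1 - 2 * M) / β + 2 * π / β * (((p.1 0).val : ℕ) : ℝ),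
        fun j => 2 * π / L * (((p.2 j).valMinAbs : ℤ) : ℝ)) := fun _ => rfl
  -- seams
  have hst : ∀ (m : ℤ) (k : Fin 2 → ℝ), (m < N ∨ ((2 * M : ℕ) : ℤ) ≤ m + N) →
      sectorSymbol e₀ μ n (ω : ℤ) (π * (1 - 2 * M) / β + 2 * π / β * (m : ℝ), k) = 0 :=
    fun m k hm => sampledSectorSymbol_time_seam hμ₁ hμ₂ he he' n (ω : ℤ) hβ hM m k hm
  have hW : 4 * (N : ℤ) * (|v 0| + |v 1| + 1) < L := by
    have h5 : 4 * (N : ℝ) * ((|(v 0 : ℝ)| + |(v 1 : ℝ)|) + 1) < L :=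
      seam_threshold_lt hvl1 hyx h1y (Nat.cast_nonneg N) (by rw [← h16]; exact hL)
    have h6 : ((4 * (N : ℤ) * (|v 0| + |v 1| + 1) : ℤ) : ℝ) < ((L : ℤ) : ℝ) := by push_cast; linarith
    exact_mod_cast h6
  have hss : ∀ (k₀ : ℝ) (m : Fin 2 → ℤ), (∃ j, (L : ℤ) ≤ 2 * |m j| + 2 * N * (|v 0| + |v 1| + 1)) →
      sectorSymbol e₀ μ n (ω : ℤ) (k₀, fun j => 2 * π / L * (m j : ℝ)) = 0 :=
    fun k₀ m hm => sampledSectorSymbol_zone_seam hμ₁ hμ₂ he he' n (ω : ℤ) hW k₀ m hm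
  -- sup
  have hAeq : (e₀ * (4 : ℝ) ^ (-(n : ℤ) - 2))⁻¹ = 16 * 4 ^ n / e₀ := by
    rw [show (-(n : ℤ) - 2) = -((n : ℤ) + 2) by ring, zpow_neg, zpow_add₀ (by norm_num), zpow_natCast]
    field_simp; norm_num
  have hA0 : 0 ≤ (e₀ * (4 : ℝ) ^ (-(n : ℤ) - 2))⁻¹ := by rw [hAeq]; positivity
  have hAb : ∀ p : TorusSite 1 (2 * M) × TorusSite 2 L,
      ‖(fun p : TorusSite 1 (2 * M) × TorusSite 2 L => sectorSymbol e₀ μ n (ω : ℤ)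
        (π * (1 - 2 * M) / β + 2 * π / β * (((p.1 0).val : ℕ) : ℝ), fun j => 2 * π / L * (((p.2 j).valMinAbs : ℤ) : ℝ))) p‖ ≤
      (e₀ * (4 : ℝ) ^ (-(n : ℤ) - 2))⁻¹ := fun p => norm_sectorSymbol_le he n (ω : ℤ) _
  -- count
  have hn := card_support_sampledSectorSymbol_le hμ₁ hμ₂ he he' n (ω : ℤ) hβ L M
  have hcount : (e₀ * (4 : ℝ) ^ (-(n : ℤ)) * β / π + 3) *
      ((Real.sqrt 2 * L * (normalExtentConst μ e₀ * (4 : ℝ) ^ (-(n : ℤ))) / π + 2) *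
        (Real.sqrt 2 * L * (tangentExtentConst μ e₀ * (2 : ℝ) ^ (-(n : ℤ))) / π + 2)) ≤
      D₀ * (β * (L : ℝ) ^ 2) * ((4 : ℝ) ^ n)⁻¹ * ((4 : ℝ) ^ n)⁻¹ * ((2 : ℝ) ^ n)⁻¹ := by
    rw [zpow_neg, zpow_neg, zpow_natCast, zpow_natCast, hD₀]
    exact count_scaling_le he hβ hx hy hLpos hC₁0 hC₂0 hβn hxL hyL
  -- the five line-derivative bounds
  have hBω := hB n ω hω
  have hωR : (((ω : ℤ) : ℝ)) = (ω : ℝ) := by simp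
  have hK₀ : ∀ (q : ℝ × (Fin 2 → ℝ)) (s : ℝ), s ∈ Set.Icc (0 : ℝ) N →
      ‖iteratedDeriv N (fun s : ℝ => sectorSymbol e₀ μ n (ω : ℤ) (q + s • (((2 * π / β), 0) : ℝ × (Fin 2 → ℝ)))) s‖ ≤
        4 ^ n * B * (4 ^ n * (2 * π / β)) ^ N := by
    intro q s _
    have h := hBω q ((2 * π / β), 0) s
    rw [dirCost_time hh₀.le] at h
    exact h
  have hK₁ : ∀ (q : ℝ × (Fin 2 → ℝ)) (s : ℝ), s ∈ Set.Icc (0 : ℝ) N →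
      ‖iteratedDeriv N (fun s : ℝ => sectorSymbol e₀ μ n (ω : ℤ)
        (q + s • (((0 : ℝ), fun j => 2 * π / L * (((![1, 0] : Fin 2 → ℤ) j : ℤ) : ℝ)) : ℝ × (Fin 2 → ℝ)))) s‖ ≤
        4 ^ n * B * (2 * 4 ^ n * (2 * π / L)) ^ N := by
    intro q s _
    refine (hBω q _ s).trans (mul_le_mul_of_nonneg_left (pow_le_pow_left₀ (by positivity) ?_ N) (by positivity))
    have h := dirCost_axis_fst (n0 := fermiNormal μ (((ω : ℝ) + 1 / 2) * sectorWidth n) 0)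
      (n1 := fermiNormal μ (((ω : ℝ) + 1 / 2) * sectorWidth n) 1)
      (t0 := fermiTangent μ (((ω : ℝ) + 1 / 2) * sectorWidth n) 0)
      (t1 := fermiTangent μ (((ω : ℝ) + 1 / 2) * sectorWidth n) 1) hhx.le hx.le hyx hy.le (by rw [hn0]; exact ht1) ht0
    exact h
  have hK₂ : ∀ (q : ℝ × (Fin 2 → ℝ)) (s : ℝ), s ∈ Set.Icc (0 : ℝ) N →
      ‖iteratedDeriv N (fun s : ℝ => sectorSymbol e₀ μ n (ω : ℤ)
        (q + s • (((0 : ℝ), fun j => 2 * π / L * (((![0, 1] : Fin 2 → ℤ) j : ℤ) : ℝ)) : ℝ × (Fin 2 → ℝ)))) s‖ ≤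
        4 ^ n * B * (2 * 4 ^ n * (2 * π / L)) ^ N := by
    intro q s _
    refine (hBω q _ s).trans (mul_le_mul_of_nonneg_left (pow_le_pow_left₀ (by positivity) ?_ N) (by positivity))
    have h := dirCost_axis_snd (n0 := fermiNormal μ (((ω : ℝ) + 1 / 2) * sectorWidth n) 0)
      (n1 := fermiNormal μ (((ω : ℝ) + 1 / 2) * sectorWidth n) 1)
      (t0 := fermiTangent μ (((ω : ℝ) + 1 / 2) * sectorWidth n) 0)
      (t1 := fermiTangent μ (((ω : ℝ) + 1 / 2) * sectorWidth n) 1) hhx.le hx.le hyx hy.le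
      (by rw [hn1, abs_neg]; exact ht0) ht1
    exact h
  have hK₃ : ∀ (q : ℝ × (Fin 2 → ℝ)) (s : ℝ), s ∈ Set.Icc (0 : ℝ) N →
      ‖iteratedDeriv N (fun s : ℝ => sectorSymbol e₀ μ n (ω : ℤ)
        (q + s • (((0 : ℝ), fun j => 2 * π / L * (((![-v 1, v 0] : Fin 2 → ℤ) j : ℤ) : ℝ)) : ℝ × (Fin 2 → ℝ)))) s‖ ≤
        4 ^ n * B * (3 * 4 ^ n * 2 ^ n * (2 * π / L)) ^ N := by
    intro q s _
    refine (hBω q _ s).trans (mul_le_mul_of_nonneg_left (pow_le_pow_left₀ (by positivity) ?_ N) (by positivity))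
    have h := dirCost_perp (x := 4 ^ n) (y := 2 ^ n) (hx := 2 * π / L)
      (t0 := fermiTangent μ (((ω : ℝ) + 1 / 2) * sectorWidth n) 0)
      (t1 := fermiTangent μ (((ω : ℝ) + 1 / 2) * sectorWidth n) 1) (v0 := v 0) (v1 := v 1)
      hhx.le hx.le hyx h1y hvt' hvn
    rw [hn0, hn1]
    exact h
  have hK₄ : ∀ (q : ℝ × (Fin 2 → ℝ)) (s : ℝ), s ∈ Set.Icc (0 : ℝ) N →
      ‖iteratedDeriv N (fun s : ℝ => sectorSymbol e₀ μ n (ω : ℤ)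
        (q + s • (((0 : ℝ), fun j => 2 * π / L * ((v j : ℤ) : ℝ)) : ℝ × (Fin 2 → ℝ)))) s‖ ≤
        4 ^ n * B * (3 * 4 ^ n * (2 * π / L)) ^ N := by
    intro q s _
    refine (hBω q _ s).trans (mul_le_mul_of_nonneg_left (pow_le_pow_left₀ (by positivity) ?_ N) (by positivity))
    have h := dirCost_tan (x := 4 ^ n) (y := 2 ^ n) (hx := 2 * π / L)
      (t0 := fermiTangent μ (((ω : ℝ) + 1 / 2) * sectorWidth n) 0)
      (t1 := fermiTangent μ (((ω : ℝ) + 1 / 2) * sectorWidth n) 1) (v0 := v 0) (v1 := v 1)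
      hhx.le hx.le hyx h1y hxy hvt' hvn
    rw [hn0, hn1]
    exact h
  -- rates
  have hs₀ : (0 : ℝ) < β / (π * 4 ^ n * M) := by positivity
  have hs₁ : (0 : ℝ) < 1 / (π * 4 ^ n) := by positivity
  have hs₂ : (0 : ℝ) < 2 / (3 * π * 4 ^ n * 2 ^ n) := by positivity
  have hs₃ : (0 : ℝ) < 2 / (3 * π * 4 ^ n) := by positivity
  have hP : ((2 * M : ℕ) : ℝ) = 2 * M := by push_cast; ring
  -- the constant of the pointwise bound
  have hT₀ : (β / (π * 4 ^ n * M) * ((2 * M : ℕ) : ℝ) / 4) ^ N * (4 ^ n * B * (4 ^ n * (2 * π / β)) ^ N) = 4 ^ n * B := by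
    rw [show β / (π * 4 ^ n * M) * ((2 * M : ℕ) : ℝ) / 4 = (4 ^ n * (2 * π / β))⁻¹ by rw [hP]; field_simp; ring]
    exact inv_pow_mul_mul_pow (by positivity) N
  have hT₁ : (1 / (π * 4 ^ n) * (L : ℝ) / 4) ^ N * (4 ^ n * B * (2 * 4 ^ n * (2 * π / L)) ^ N) = 4 ^ n * B := by
    rw [show 1 / (π * 4 ^ n) * (L : ℝ) / 4 = (2 * 4 ^ n * (2 * π / L))⁻¹ by field_simp; ring]
    exact inv_pow_mul_mul_pow (by positivity) N
  have hT₃ : (2 / (3 * π * 4 ^ n * 2 ^ n) * (L : ℝ) / 4) ^ N * (4 ^ n * B * (3 * 4 ^ n * 2 ^ n * (2 * π / L)) ^ N) =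
      4 ^ n * B := by
    rw [show 2 / (3 * π * 4 ^ n * 2 ^ n) * (L : ℝ) / 4 = (3 * 4 ^ n * 2 ^ n * (2 * π / L))⁻¹ by field_simp; ring]
    exact inv_pow_mul_mul_pow (by positivity) N
  have hT₄ : (2 / (3 * π * 4 ^ n) * (L : ℝ) / 4) ^ N * (4 ^ n * B * (3 * 4 ^ n * (2 * π / L)) ^ N) = 4 ^ n * B := by
    rw [show 2 / (3 * π * 4 ^ n) * (L : ℝ) / 4 = (3 * 4 ^ n * (2 * π / L))⁻¹ by field_simp; ring]
    exact inv_pow_mul_mul_pow (by positivity) N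
  have hKsum : ((N : ℝ) + 1) *
      ((β / (π * 4 ^ n * M) * ((2 * M : ℕ) : ℝ) / 4) ^ N * (4 ^ n * B * (4 ^ n * (2 * π / β)) ^ N) +
        (1 / (π * 4 ^ n) * (L : ℝ) / 4) ^ N *
          (4 ^ n * B * (2 * 4 ^ n * (2 * π / L)) ^ N + 4 ^ n * B * (2 * 4 ^ n * (2 * π / L)) ^ N) +
        (2 / (3 * π * 4 ^ n * 2 ^ n) * (L : ℝ) / 4) ^ N * (4 ^ n * B * (3 * 4 ^ n * 2 ^ n * (2 * π / L)) ^ N) +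
        (2 / (3 * π * 4 ^ n) * (L : ℝ) / 4) ^ N * (4 ^ n * B * (3 * 4 ^ n * (2 * π / L)) ^ N)) =
      5 * ((N : ℝ) + 1) * (4 ^ n * B) := by
    rw [mul_add ((1 / (π * 4 ^ n) * (L : ℝ) / 4) ^ N), hT₀, hT₁, hT₃, hT₄]; ring
  have hR1 : (6 : ℝ) ^ N * ((e₀ * (4 : ℝ) ^ (-(n : ℤ)) * β / π + 3) *
      ((Real.sqrt 2 * L * (normalExtentConst μ e₀ * (4 : ℝ) ^ (-(n : ℤ))) / π + 2) *
        (Real.sqrt 2 * L * (tangentExtentConst μ e₀ * (2 : ℝ) ^ (-(n : ℤ))) / π + 2)) *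
      ((e₀ * (4 : ℝ) ^ (-(n : ℤ) - 2))⁻¹ + ((N : ℝ) + 1) *
      ((β / (π * 4 ^ n * M) * ((2 * M : ℕ) : ℝ) / 4) ^ N * (4 ^ n * B * (4 ^ n * (2 * π / β)) ^ N) +
        (1 / (π * 4 ^ n) * (L : ℝ) / 4) ^ N *
          (4 ^ n * B * (2 * 4 ^ n * (2 * π / L)) ^ N + 4 ^ n * B * (2 * 4 ^ n * (2 * π / L)) ^ N) +
        (2 / (3 * π * 4 ^ n * 2 ^ n) * (L : ℝ) / 4) ^ N * (4 ^ n * B * (3 * 4 ^ n * 2 ^ n * (2 * π / L)) ^ N) +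
        (2 / (3 * π * 4 ^ n) * (L : ℝ) / 4) ^ N * (4 ^ n * B * (3 * 4 ^ n * (2 * π / L)) ^ N)))) ≤
      Ca * (β * (L : ℝ) ^ 2) * ((4 : ℝ) ^ n)⁻¹ * ((2 : ℝ) ^ n)⁻¹ := by
    rw [hKsum, hAeq]
    have hfac : 0 ≤ 16 * 4 ^ n / e₀ + 5 * ((N : ℝ) + 1) * (4 ^ n * B) := by positivity
    calc (6 : ℝ) ^ N * ((e₀ * (4 : ℝ) ^ (-(n : ℤ)) * β / π + 3) *
        ((Real.sqrt 2 * L * (normalExtentConst μ e₀ * (4 : ℝ) ^ (-(n : ℤ))) / π + 2) *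
          (Real.sqrt 2 * L * (tangentExtentConst μ e₀ * (2 : ℝ) ^ (-(n : ℤ))) / π + 2)) *
        (16 * 4 ^ n / e₀ + 5 * ((N : ℝ) + 1) * (4 ^ n * B)))
        ≤ (6 : ℝ) ^ N * ((D₀ * (β * (L : ℝ) ^ 2) * ((4 : ℝ) ^ n)⁻¹ * ((4 : ℝ) ^ n)⁻¹ * ((2 : ℝ) ^ n)⁻¹) *
            (16 * 4 ^ n / e₀ + 5 * ((N : ℝ) + 1) * (4 ^ n * B))) :=
          mul_le_mul_of_nonneg_left (mul_le_mul_of_nonneg_right hcount hfac) (by positivity)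
      _ = Ca * (β * (L : ℝ) ^ 2) * ((4 : ℝ) ^ n)⁻¹ * ((2 : ℝ) ^ n)⁻¹ := by
          rw [hCa]; field_simp
  have hCaC : Ca ≤ Ca * (1 + 16 * (π + 1) * D₁) :=
    le_mul_of_one_le_right hCa0 (le_add_of_nonneg_right (by positivity))
  have hscale0 : 0 ≤ β * (L : ℝ) ^ 2 * ((4 : ℝ) ^ n)⁻¹ * ((2 : ℝ) ^ n)⁻¹ := by positivity
  have hR10 : 0 ≤ Ca * (β * (L : ℝ) ^ 2) * ((4 : ℝ) ^ n)⁻¹ * ((2 : ℝ) ^ n)⁻¹ := by positivity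
  -- the near radius and the three factors of the volume bound
  have hR₀ : 2 * (|v 0| + |v 1|) * ((4 * 8 ^ n : ℕ) : ℤ) < L := by
    have h1 : 2 * (|(v 0 : ℝ)| + |(v 1 : ℝ)|) * (4 * ((4 : ℝ) ^ n * 2 ^ n)) < L :=
      nearRadius_threshold_lt hvl1 hxy h1y (Nat.cast_nonneg N) (by rw [← h16]; exact hL)
    have h5 : ((2 * (|v 0| + |v 1|) * ((4 * 8 ^ n : ℕ) : ℤ) : ℤ) : ℝ) < ((L : ℤ) : ℝ) := by
      push_cast; rw [h8]; linarith
    exact_mod_cast h5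
  have hR₀c : (((4 * 8 ^ n : ℕ) : ℝ)) = 4 * 4 ^ n * 2 ^ n := by push_cast; rw [h8]; ring
  have hvpos : 0 < Real.sqrt ((v 0 : ℝ) ^ 2 + (v 1 : ℝ) ^ 2) := lt_of_lt_of_le (by positivity) hvlen
  have hnear : 8 * ((2 * Real.sqrt 2 / (2 / (3 * π * 4 ^ n * 2 ^ n) * Real.sqrt ((v 0 : ℝ) ^ 2 + (v 1 : ℝ) ^ 2)) + 2) *
      (2 * Real.sqrt 2 / (2 / (3 * π * 4 ^ n) * Real.sqrt ((v 0 : ℝ) ^ 2 + (v 1 : ℝ) ^ 2)) + 2)) ≤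
      8 * (6 * Real.sqrt 2 * π + 2) ^ 2 * (4 ^ n * 2 ^ n) := by
    refine nearFactor_le h1x h1y (by positivity) (by positivity) ?_ ?_
    · rw [show (3 * π * (4 : ℝ) ^ n)⁻¹ = 2 / (3 * π * 4 ^ n * 2 ^ n) * (2 ^ n / 2) by field_simp]
      exact mul_le_mul_of_nonneg_left hvlen hs₂.le
    · rw [show (3 * π * (2 : ℝ) ^ n)⁻¹ = 2 / (3 * π * 4 ^ n) * (2 ^ n / 2) by rw [hxy]; field_simp]
      exact mul_le_mul_of_nonneg_left hvlen hs₃.le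
  have hfar : (1 + 1 / (π * 4 ^ n) * (4 * 4 ^ n * 2 ^ n))⁻¹ ^ (N - Nw - 6) * (32 * (1 / (1 / (π * 4 ^ n)) + 1) ^ 2) ≤
      8 * π * (π + 1) ^ 2 * (4 ^ n * 2 ^ n) :=
    farFactor_le h1x h1y hxy (by omega)
  have htime : β / (2 * M) * (32 * (1 / (β / (π * 4 ^ n * M)) + 1)) ≤ 16 * (π + 1) * 4 ^ n :=
    timeFactor_le hβ hMpos hβM h1x
  have hnear0 : 0 ≤ 8 * ((2 * Real.sqrt 2 / (2 / (3 * π * 4 ^ n * 2 ^ n) * Real.sqrt ((v 0 : ℝ) ^ 2 + (v 1 : ℝ) ^ 2)) + 2) *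
      (2 * Real.sqrt 2 / (2 / (3 * π * 4 ^ n) * Real.sqrt ((v 0 : ℝ) ^ 2 + (v 1 : ℝ) ^ 2)) + 2)) := by positivity
  have hfar0 : 0 ≤ (1 + 1 / (π * 4 ^ n) * (4 * 4 ^ n * 2 ^ n))⁻¹ ^ (N - Nw - 6) * (32 * (1 / (1 / (π * 4 ^ n)) + 1) ^ 2) := by
    positivity
  have htime0 : 0 ≤ 32 * (1 / (β / (π * 4 ^ n * M)) + 1) := by positivity
  have hεpos : 0 ≤ β / (2 * M) := by positivity
  have hfin0 : 0 ≤ β * (L : ℝ) ^ 2 * (4 : ℝ) ^ n := by positivity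
  -- the pointwise bound and the weighted sum
  have P1 := norm_charSum_mul_decayFactor_pow_le (P := 2 * M) (L := L) (sectorSymbol e₀ μ n (ω : ℤ))
    (π * (1 - 2 * M) / β) (2 * π / β) (2 * π / L) N hΦs _ hG v hst hss hA0 hAb hn hK₀ hK₁ hK₂ hK₃ hK₄
    hs₀.le hs₁.le hs₂.le hs₃.le
  have P2 := sum_weight_mul_norm_charSum_le (P := 2 * M) (L := L) (sectorSymbol e₀ μ n (ω : ℤ))
    (π * (1 - 2 * M) / β) (2 * π / β) (2 * π / L) N hΦs _ hG v hv0 hst hss hA0 hAb hn hK₀ hK₁ hK₂ hK₃ hK₄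
    hs₀ hs₁ hs₂ hs₃ hR₀ (Nw := Nw) (by omega) (ct := β / (π * 4 ^ n * M)) (cx := 1 / (π * 4 ^ n))
    hs₀.le le_rfl hs₁.le le_rfl
  rw [hR₀c] at P2
  refine ⟨fun z => ?_, ?_⟩
  · -- (sup)
    have h := P1 z
    clear P1 P2
    have h1 : 0 ≤ β / (π * 4 ^ n * M) * |((((z.1 0).valMinAbs : ℤ)) : ℝ)| := mul_nonneg hs₀.le (abs_nonneg _)
    have h2 : 0 ≤ 1 / (π * 4 ^ n) * (|((((z.2 0).valMinAbs : ℤ)) : ℝ)| + |((((z.2 1).valMinAbs : ℤ)) : ℝ)|) :=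
      mul_nonneg hs₁.le (add_nonneg (abs_nonneg _) (abs_nonneg _))
    have h3 : 0 ≤ 2 / (3 * π * 4 ^ n * 2 ^ n) * |(((∑ j, ((![-v 1, v 0] j : ℤ) : ZMod L) * z.2 j).valMinAbs : ℤ) : ℝ)| :=
      mul_nonneg hs₂.le (abs_nonneg _)
    have h4 : 0 ≤ 2 / (3 * π * 4 ^ n) * |(((∑ j, ((v j : ℤ) : ZMod L) * z.2 j).valMinAbs : ℤ) : ℝ)| :=
      mul_nonneg hs₃.le (abs_nonneg _)
    have hD1 : (1 : ℝ) ≤ 1 + β / (π * 4 ^ n * M) * |((((z.1 0).valMinAbs : ℤ)) : ℝ)| +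
        1 / (π * 4 ^ n) * (|((((z.2 0).valMinAbs : ℤ)) : ℝ)| + |((((z.2 1).valMinAbs : ℤ)) : ℝ)|) +
        2 / (3 * π * 4 ^ n * 2 ^ n) * |(((∑ j, ((![-v 1, v 0] j : ℤ) : ZMod L) * z.2 j).valMinAbs : ℤ) : ℝ)| +
        2 / (3 * π * 4 ^ n) * |(((∑ j, ((v j : ℤ) : ZMod L) * z.2 j).valMinAbs : ℤ) : ℝ)| := by
      linarith only [h1, h2, h3, h4]
    refine le_trans (le_mul_of_one_le_right (norm_nonneg _) (one_le_pow₀ hD1)) (h.trans (hR1.trans ?_))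
    calc Ca * (β * (L : ℝ) ^ 2) * ((4 : ℝ) ^ n)⁻¹ * ((2 : ℝ) ^ n)⁻¹ = Ca * (β * (L : ℝ) ^ 2 * ((4 : ℝ) ^ n)⁻¹ * ((2 : ℝ) ^ n)⁻¹) := by ring
      _ ≤ Ca * (1 + 16 * (π + 1) * D₁) * (β * (L : ℝ) ^ 2 * ((4 : ℝ) ^ n)⁻¹ * ((2 : ℝ) ^ n)⁻¹) :=
          mul_le_mul_of_nonneg_right hCaC hscale0
      _ = Ca * (1 + 16 * (π + 1) * D₁) * (β * (L : ℝ) ^ 2) * ((4 : ℝ) ^ n)⁻¹ * ((2 : ℝ) ^ n)⁻¹ := by ring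
  · -- (weighted L¹): abbreviate the factors and assemble
    clear P1
    generalize hT : (32 * (1 / (β / (π * 4 ^ n * M)) + 1) : ℝ) = T at P2 htime htime0
    generalize hVn : (8 * ((2 * Real.sqrt 2 / (2 / (3 * π * 4 ^ n * 2 ^ n) * Real.sqrt ((v 0 : ℝ) ^ 2 + (v 1 : ℝ) ^ 2)) + 2) *
        (2 * Real.sqrt 2 / (2 / (3 * π * 4 ^ n) * Real.sqrt ((v 0 : ℝ) ^ 2 + (v 1 : ℝ) ^ 2)) + 2)) : ℝ) = Vn at P2 hnear hnear0
    generalize hVf : ((1 + 1 / (π * 4 ^ n) * (4 * 4 ^ n * 2 ^ n))⁻¹ ^ (N - Nw - 6) * (32 * (1 / (1 / (π * 4 ^ n)) + 1) ^ 2) : ℝ) =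
        Vf at P2 hfar hfar0
    generalize hR : ((6 : ℝ) ^ N * ((e₀ * (4 : ℝ) ^ (-(n : ℤ)) * β / π + 3) *
      ((Real.sqrt 2 * L * (normalExtentConst μ e₀ * (4 : ℝ) ^ (-(n : ℤ))) / π + 2) *
        (Real.sqrt 2 * L * (tangentExtentConst μ e₀ * (2 : ℝ) ^ (-(n : ℤ))) / π + 2)) *
      ((e₀ * (4 : ℝ) ^ (-(n : ℤ) - 2))⁻¹ + ((N : ℝ) + 1) *
      ((β / (π * 4 ^ n * M) * ((2 * M : ℕ) : ℝ) / 4) ^ N * (4 ^ n * B * (4 ^ n * (2 * π / β)) ^ N) +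
        (1 / (π * 4 ^ n) * (L : ℝ) / 4) ^ N *
          (4 ^ n * B * (2 * 4 ^ n * (2 * π / L)) ^ N + 4 ^ n * B * (2 * 4 ^ n * (2 * π / L)) ^ N) +
        (2 / (3 * π * 4 ^ n * 2 ^ n) * (L : ℝ) / 4) ^ N * (4 ^ n * B * (3 * 4 ^ n * 2 ^ n * (2 * π / L)) ^ N) +
        (2 / (3 * π * 4 ^ n) * (L : ℝ) / 4) ^ N * (4 ^ n * B * (3 * 4 ^ n * (2 * π / L)) ^ N))))) = R at P2 hR1 hR10
    generalize hx' : ((4 : ℝ) ^ n) = x at P2 hR1 hR10 hnear hfar htime hfin0 hx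
    generalize hy' : ((2 : ℝ) ^ n) = y at P2 hR1 hR10 hnear hfar hy
    generalize hε : (β / (2 * M) : ℝ) = ε at P2 htime hεpos ⊢
    have hQ0 : 0 ≤ β * (L : ℝ) ^ 2 := by positivity
    generalize hQ : (β * (L : ℝ) ^ 2 : ℝ) = Q at hR1 hR10 hfin0 hQ0 ⊢
    -- `P2 : S ≤ R * (T * (Vn + Vf))`
    refine le_trans (mul_le_mul_of_nonneg_left P2 hεpos) ?_
    clear P2 hG hAb hn hK₀ hK₁ hK₂ hK₃ hK₄ hBω hB hst hss hKsum hT₀ hT₁ hT₃ hT₄ hcount hR hVn hVf hT hx' hy' hε hQ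
    have hV : Vn + Vf ≤ D₁ * (x * y) := by rw [hD₁, add_mul]; exact add_le_add hnear hfar
    have hpos1 : 0 ≤ Ca * Q * x⁻¹ * y⁻¹ * (16 * (π + 1) * x) :=
      mul_nonneg hR10 (mul_nonneg (mul_nonneg (by norm_num) (by linarith only [hπ])) hx.le)
    have hV0 : 0 ≤ Vn + Vf := add_nonneg hnear0 hfar0
    calc ε * (R * (T * (Vn + Vf))) = R * (ε * T) * (Vn + Vf) := by ring
      _ ≤ (Ca * Q * x⁻¹ * y⁻¹) * (16 * (π + 1) * x) * (D₁ * (x * y)) :=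
          mul_le_mul (mul_le_mul hR1 htime (mul_nonneg hεpos htime0) hR10) hV hV0 hpos1
      _ = Ca * (16 * (π + 1) * D₁) * Q * x * (x⁻¹ * x) * (y⁻¹ * y) := by ring
      _ = Ca * (16 * (π + 1) * D₁) * Q * x := by rw [inv_mul_cancel₀ hx.ne', inv_mul_cancel₀ hy.ne']; ring
      _ ≤ Ca * (1 + 16 * (π + 1) * D₁) * Q * x := by
          have h1 : Ca * (16 * (π + 1) * D₁) ≤ Ca * (1 + 16 * (π + 1) * D₁) :=
            mul_le_mul_of_nonneg_left (le_add_of_nonneg_left zero_le_one) hCa0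
          exact mul_le_mul_of_nonneg_right (mul_le_mul_of_nonneg_right h1 hQ0) hx.le

end Main


end Literature.MathematicalPhysics.QuantumLattice
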